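import Summits.CriticalPhenomena.Ising3DConformalLimit.Theses.OctantEntropy

/-!
# OctantEntropy — assembly glue (item stmt-CriticalPhenomena-5738)

The chain of route `OctantEntropy` as one implication, pure logic plus one line of limit
arithmetic:
QuenchedMassExponent → MonofractalMass → FirstMomentBoxSum → BoxSumToEta → EtaToMoebiusLimit →
NonGaussianLimit → `Ising3DConformalLimit`.

Proof: from Q (`a_K/K → D`), M (`(b_K − a_K)/K → 0`) and F (`(b_K − log₂ S_K)/K → 0`) the
identity `log₂ S_K/K = a_K/K + (b_K − a_K)/K − (b_K − log₂ S_K)/K` (valid also at `K = 0` with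
`x/0 = 0`) gives `log₂ S_K/K → D`; BoxSumToEta yields `∃ η, HasIsingExponentEta 3 η`;
EtaToMoebiusLimit turns it into a non-degenerate Möbius-covariant pointwise scaling limit
`(ρ, Δ, S)`; NonGaussianLimit supplies clause (iii) `HasNontrivialU4 S`.
-/

namespace Summit.CriticalPhenomena.Ising3DConformalLimit.Theorems

open Filter Literature.Probability.LatticeModels

/-- **Assembly glue of route OctantEntropy** (item stmt-CriticalPhenomena-5738): the
implication QuenchedMassExponent → MonofractalMass → FirstMomentBoxSum → BoxSumToEta →
EtaToMoebiusLimit → NonGaussianLimit → `Ising3DConformalLimit`, proved by pure logic and the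
limit arithmetic `a_K/K + (b_K − a_K)/K − (b_K − log₂ S_K)/K = log₂ S_K/K` (so the window-sum
exponent tends to the quenched exponent `D`); BoxSumToEta gives `η`, EtaToMoebiusLimit the
Möbius-covariant non-degenerate limit `(ρ, Δ, S)`, and NonGaussianLimit clause (iii). [folklore] -/
theorem octantEntropy_assembly_proof :
    Summit.CriticalPhenomena.Ising3DConformalLimit.Theses.OctantEntropy.Assembly := by
  unfold Summit.CriticalPhenomena.Ising3DConformalLimit.Theses.OctantEntropy.Assembly
  intro hQ hM hF hB hC hN
  obtain ⟨D, hD⟩ := hQ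
  -- limit arithmetic: a_K/K + (b_K − a_K)/K − (b_K − log₂ S_K)/K → D + 0 − 0
  have h1 := (hD.add hM).sub hF
  simp only [add_zero, sub_zero] at h1
  -- the window-sum exponent exists, hence η exists
  obtain ⟨η, hη⟩ := hB ⟨D, h1.congr fun K => by ring⟩
  -- η ⇒ Möbius-covariant non-degenerate pointwise scaling limit
  obtain ⟨ρ, Δ, S, hρ, hΔ, hlim, hnd, hmob⟩ := hC ⟨η, hη⟩
  -- clause (iii) from NonGaussianLimit
  exact ⟨ρ, Δ, S, hρ, hΔ, hlim, hnd, hmob, hN ρ S hρ hlim hnd⟩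

end Summit.CriticalPhenomena.Ising3DConformalLimit.Theorems
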